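import Literature.Topology.FourManifolds.RegularLevelSplitting
import Mathlib.Analysis.SpecialFunctions.SmoothTransition
import Mathlib.Analysis.InnerProductSpace.Calculus
import Mathlib.Analysis.Complex.RealDeriv
import HarnessLib

/-!
# The standard Lefschetz base of genus `g`: a rounded tube around the Milnor fibre
# `y² = x^{2g+1} + 1` in `ℂ²`

Topic `Literature/Topology/FourManifolds`; namespace `Literature.Topology.FourManifolds.LefschetzBase`.
Vocabulary file (definitions + proved lemmas, NOTHING asserted) for the Lefschetz-handlebody
language of `LefschetzHandlebody.lean` (consumer: crux `ConvexBisection.AcyclicBisectionExists`,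
stmt-SmoothPoincare4-10508, line `modp-braid-orbits`).

A (possibly achiral) Lefschetz fibration over the disc with bounded fibre `F = F_{g,1}` is, as a
handlebody, `F × D²` with 2-handles attached along curves lying in distinct fibres `F × {θ}` of
`∂(F × D²) ⊃ F × S¹` with framing `∓1` relative to the fibre framing (Kas 1980; Harer 1979;
Gompf–Stipsicz 1999, §8.2; Etnyre–Fuller 2006, §2).  This file provides the base `F × D²` as a
CONCRETE compact smooth 4-manifold with boundary inside `ℂ² = ℝ⁴`, with the fibres of an
explicit polynomial as pages, so that "curve in a page" and "page framing" become formulas: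

* coordinates `cx p = p₀ + i p₁`, `cy p = p₂ + i p₃` on `𝔼 4 = ℝ⁴ = ℂ²` (§1);
* `Phi g (x, y) = y² − x^{2g+1}` and `w = Phi − 1`; the central page is the affine Milnor fibre
  `{y² = x^{2g+1} + 1}` of the `A_{2g}` singularity — a genus-`g` curve with ONE point at infinity,
  so that its part over a large disc `|x| ≤ r` is the surface `F_{g,1}` (double cover of the disc
  branched at the `2g+1` roots of `x^{2g+1} = −1`);
* the cut-off `eta s = expNegInvGlue (s − 4)` (zero for `|x| ≤ 2`, positive and strictly increasing
  beyond, with its derivative `hasDerivAt_eta`) and the defining function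
  `rho g p = ‖Phi g p − 1‖² + eta ‖cx p‖²` (§2), smooth (`contDiff_rho`);
* the two families of lines `lineX p u t = p + t(u, 0)`, `lineY p c t = p + t(0, c)` along which the
  sequel differentiates `rho`.

The sequel `LefschetzBaseRegular.lean` proves that `1/4` is a regular value of `rho g` (the cut-off
depends on `x` only, which is what makes the tube corner-free without any corner-rounding) and
builds the compact base `Base g = {rho g ≤ 1/4}` as a `RegularSublevel`.  On paper (not used
formally) `Base g ≅ F_{g,1} × D² ≅ ♮^{2g} S¹ × B³`, the compact 4-dimensional 1-handlebody with `2g`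
one-handles (Gompf–Stipsicz 1999, §4.6), whose boundary self-diffeomorphisms all extend
(Laudenbach–Poénaru 1972; tree fact `Literature.Topology.FourManifolds.exists_diffeomorph_comp_incl_eq`).

## References
* A. Kas, *On the handlebody decomposition associated to a Lefschetz fibration*, Pacific J. Math.
  89 (1980), 89–104.
* R. E. Gompf, A. I. Stipsicz, *4-Manifolds and Kirby Calculus*, GSM 20 (1999), §8.2.
* J. B. Etnyre, T. Fuller, *Realizing 4-manifolds as achiral Lefschetz fibrations*, IMRN 2006,
  §2. [EtnyreFuller2006]
* J. Milnor, *Singular points of complex hypersurfaces*, Ann. of Math. Studies 61 (1968), §9.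
-/

noncomputable section

open scoped Manifold ContDiff Topology ComplexConjugate
open Set Function Metric

namespace Literature.Topology.FourManifolds

/-- Local notation: `𝔼 n` is the model Euclidean space `EuclideanSpace ℝ (Fin n)`. -/
local notation "𝔼 " n:arg => EuclideanSpace ℝ (Fin n)

namespace LefschetzBase

/-! ## §1 Complex coordinates on `ℝ⁴ = ℂ²` -/

/-- The first complex coordinate `x = p₀ + i p₁` of `p ∈ ℝ⁴ = ℂ²`. [folklore] -/
def cx (p : 𝔼 4) : ℂ := ⟨p 0, p 1⟩

/-- The second complex coordinate `y = p₂ + i p₃` of `p ∈ ℝ⁴ = ℂ²`. [folklore] -/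
def cy (p : 𝔼 4) : ℂ := ⟨p 2, p 3⟩

/-- The point of `ℝ⁴` with complex coordinates `(a, b)`. [folklore] -/
def mk (a b : ℂ) : 𝔼 4 := WithLp.toLp 2 ![a.re, a.im, b.re, b.im]

/-- `cx (mk a b) = a`. [folklore] -/
@[simp] theorem cx_mk (a b : ℂ) : cx (mk a b) = a := by
  apply Complex.ext <;> simp [cx, mk]

/-- `cy (mk a b) = b`. [folklore] -/
@[simp] theorem cy_mk (a b : ℂ) : cy (mk a b) = b := by
  apply Complex.ext <;> simp [cy, mk]

/-- `(cx p, cy p)` recovers `p`. [folklore] -/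
theorem mk_cx_cy (p : 𝔼 4) : mk (cx p) (cy p) = p := by
  ext i
  fin_cases i <;> simp [mk, cx, cy]

/-- `cx` is real-linear and continuous. [folklore] -/
def cxL : 𝔼 4 →L[ℝ] ℂ :=
  (EuclideanSpace.proj (0 : Fin 4)).smulRight (1 : ℂ) +
    (EuclideanSpace.proj (1 : Fin 4)).smulRight Complex.I

/-- `cy` is real-linear and continuous. [folklore] -/
def cyL : 𝔼 4 →L[ℝ] ℂ :=
  (EuclideanSpace.proj (2 : Fin 4)).smulRight (1 : ℂ) +
    (EuclideanSpace.proj (3 : Fin 4)).smulRight Complex.I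

/-- The continuous linear map `cxL` is `cx`. [folklore] -/
@[simp] theorem cxL_apply (p : 𝔼 4) : cxL p = cx p := by
  apply Complex.ext <;> simp [cxL, cx]

/-- The continuous linear map `cyL` is `cy`. [folklore] -/
@[simp] theorem cyL_apply (p : 𝔼 4) : cyL p = cy p := by
  apply Complex.ext <;> simp [cyL, cy]

/-- `cx` as a continuous linear map. [folklore] -/
theorem cx_eq : cx = cxL := funext fun p => (cxL_apply p).symm

/-- `cy` as a continuous linear map. [folklore] -/
theorem cy_eq : cy = cyL := funext fun p => (cyL_apply p).symm

/-- `cx` is smooth. [folklore] -/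
theorem contDiff_cx : ContDiff ℝ ∞ cx := by rw [cx_eq]; exact cxL.contDiff

/-- `cy` is smooth. [folklore] -/
theorem contDiff_cy : ContDiff ℝ ∞ cy := by rw [cy_eq]; exact cyL.contDiff

/-- `cx` is additive. [folklore] -/
theorem cx_add (p q : 𝔼 4) : cx (p + q) = cx p + cx q := by
  rw [cx_eq]; exact map_add cxL p q

/-- `cy` is additive. [folklore] -/
theorem cy_add (p q : 𝔼 4) : cy (p + q) = cy p + cy q := by
  rw [cy_eq]; exact map_add cyL p q

/-- `cx` commutes with real scalars. [folklore] -/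
theorem cx_smul (t : ℝ) (p : 𝔼 4) : cx (t • p) = (t : ℂ) * cx p := by
  rw [cx_eq, map_smul, Complex.real_smul]

/-- `cy` commutes with real scalars. [folklore] -/
theorem cy_smul (t : ℝ) (p : 𝔼 4) : cy (t • p) = (t : ℂ) * cy p := by
  rw [cy_eq, map_smul, Complex.real_smul]

/-- `‖p‖² = ‖x‖² + ‖y‖²`. [folklore] -/
theorem norm_sq_eq (p : 𝔼 4) : ‖p‖ ^ 2 = ‖cx p‖ ^ 2 + ‖cy p‖ ^ 2 := by
  rw [EuclideanSpace.norm_sq_eq, Complex.sq_norm, Complex.sq_norm, Complex.normSq_apply,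
    Complex.normSq_apply, Fin.sum_univ_four]
  simp only [Real.norm_eq_abs, sq_abs, cx, cy]
  ring

/-! ## §2 The polynomial `Phi`, the cut-off `eta` and the defining function `rho` -/

/-- `Phi g (x, y) = y² − x^{2g+1}` (the `A_{2g}` polynomial; its fibre over `1` is the central
page). [cite: Milnor1968, §9] -/
def Phi (g : ℕ) (p : 𝔼 4) : ℂ := cy p ^ 2 - cx p ^ (2 * g + 1)

/-- `w = Phi − 1`, vanishing exactly on the central page `y² = x^{2g+1} + 1`. [folklore] -/
def w (g : ℕ) (p : 𝔼 4) : ℂ := Phi g p - 1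

/-- The cut-off `eta s = expNegInvGlue (s − 4)`: zero for `s ≤ 4`, positive and strictly increasing
for `s > 4`, smooth, with values in `[0, 1)`. [folklore] -/
def eta (s : ℝ) : ℝ := expNegInvGlue (s - 4)

/-- **The defining function** `rho g p = ‖Phi g p − 1‖² + eta ‖cx p‖²` of the base. [folklore] -/
def rho (g : ℕ) (p : 𝔼 4) : ℝ := ‖w g p‖ ^ 2 + eta (‖cx p‖ ^ 2)

/-- `Phi g` is smooth (a polynomial in the real coordinates). [folklore] -/
theorem contDiff_Phi (g : ℕ) : ContDiff ℝ ∞ (Phi g) :=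
  (contDiff_cy.pow 2).sub (contDiff_cx.pow _)

/-- `w g` is smooth. [folklore] -/
theorem contDiff_w (g : ℕ) : ContDiff ℝ ∞ (w g) := (contDiff_Phi g).sub contDiff_const

/-- The cut-off is smooth. [folklore] -/
theorem contDiff_eta : ContDiff ℝ ∞ eta :=
  expNegInvGlue.contDiff.comp (contDiff_id.sub contDiff_const)

/-- The cut-off is non-negative. [folklore] -/
theorem eta_nonneg (s : ℝ) : 0 ≤ eta s := expNegInvGlue.nonneg _

/-- The cut-off vanishes on the flat region `s ≤ 4`. [folklore] -/
theorem eta_of_le {s : ℝ} (hs : s ≤ 4) : eta s = 0 := expNegInvGlue.zero_of_nonpos (by linarith)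

/-- The cut-off is positive beyond the flat region. [folklore] -/
theorem eta_pos {s : ℝ} (hs : 4 < s) : 0 < eta s := expNegInvGlue.pos_of_pos (by linarith)

/-- The cut-off is monotone. [folklore] -/
theorem eta_monotone : Monotone eta := fun _ _ h => expNegInvGlue.monotone (by linarith)

/-- Beyond the flat region the cut-off is `exp (−1/(s−4))`. [folklore] -/
theorem eta_eq_exp {s : ℝ} (hs : 4 < s) : eta s = Real.exp (-(s - 4)⁻¹) := by
  simp [eta, expNegInvGlue, not_le.2 (sub_pos.2 hs)]

/-- `eta 6 ≥ 1/2` (from `1 + u ≤ exp u`). [folklore] -/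
theorem half_le_eta_six : (1 / 2 : ℝ) ≤ eta 6 := by
  rw [eta_eq_exp (by norm_num)]
  have h1 := Real.add_one_le_exp (-(6 - 4 : ℝ)⁻¹)
  have h2 : (-(6 - 4 : ℝ)⁻¹ + 1) = 1 / 2 := by norm_num
  linarith

/-- The derivative of the cut-off beyond the flat region: `eta' s = exp(−1/(s−4)) / (s−4)² > 0`.
[folklore] -/
theorem hasDerivAt_eta {s : ℝ} (hs : 4 < s) :
    HasDerivAt eta (Real.exp (-(s - 4)⁻¹) * (s - 4)⁻¹ ^ 2) s := by
  have hne : s - 4 ≠ 0 := (sub_pos.2 hs).ne'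
  have h1 : HasDerivAt (fun u : ℝ => -(u - 4)⁻¹) ((s - 4)⁻¹ ^ 2) s := by
    have h0 : HasDerivAt (fun u : ℝ => -(u - 4)⁻¹) (-(-1 / (s - 4) ^ 2)) s :=
      (((hasDerivAt_id' s).sub_const 4).inv hne).neg
    have he : -(-1 / (s - 4) ^ 2) = (s - 4)⁻¹ ^ 2 := by
      rw [neg_div, neg_neg, one_div, inv_pow]
    rwa [he] at h0
  have h2 : HasDerivAt (fun u : ℝ => Real.exp (-(u - 4)⁻¹))
      (Real.exp (-(s - 4)⁻¹) * (s - 4)⁻¹ ^ 2) s := h1.exp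
  refine h2.congr_of_eventuallyEq ?_
  filter_upwards [lt_mem_nhds hs] with u hu
  exact eta_eq_exp hu

/-- The cut-off has positive derivative beyond the flat region. [folklore] -/
theorem deriv_eta_pos {s : ℝ} (hs : 4 < s) : 0 < deriv eta s := by
  rw [(hasDerivAt_eta hs).deriv]
  exact mul_pos (Real.exp_pos _) (pow_pos (inv_pos.2 (sub_pos.2 hs)) 2)

/-- `‖z‖²` on `ℂ` is smooth as a real function. [folklore] -/
theorem contDiff_norm_sq_complex : ContDiff ℝ ∞ fun z : ℂ => ‖z‖ ^ 2 := contDiff_norm_sq ℝ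

/-- The defining function `rho g` is smooth. [folklore] -/
theorem contDiff_rho (g : ℕ) : ContDiff ℝ ∞ (rho g) :=
  (contDiff_norm_sq_complex.comp (contDiff_w g)).add
    (contDiff_eta.comp (contDiff_norm_sq_complex.comp contDiff_cx))

/-- `rho g ≥ 0`. [folklore] -/
theorem rho_nonneg (g : ℕ) (p : 𝔼 4) : 0 ≤ rho g p :=
  add_nonneg (sq_nonneg _) (eta_nonneg _)

/-! ### Values of the coordinates along the two families of lines used in §3 -/

/-- The `x`-direction line through `p` with complex velocity `u`. [folklore] -/
def lineX (p : 𝔼 4) (u : ℂ) (t : ℝ) : 𝔼 4 := p + t • mk u 0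

/-- The `y`-direction line through `p` with complex velocity `c`. [folklore] -/
def lineY (p : 𝔼 4) (c : ℂ) (t : ℝ) : 𝔼 4 := p + t • mk 0 c

/-- `x`-coordinate along the `x`-line. [folklore] -/
@[simp] theorem cx_lineX (p : 𝔼 4) (u : ℂ) (t : ℝ) : cx (lineX p u t) = cx p + t * u := by
  simp [lineX, cx_add, cx_smul]

/-- `y`-coordinate along the `x`-line (constant). [folklore] -/
@[simp] theorem cy_lineX (p : 𝔼 4) (u : ℂ) (t : ℝ) : cy (lineX p u t) = cy p := by
  simp [lineX, cy_add, cy_smul]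

/-- `x`-coordinate along the `y`-line (constant). [folklore] -/
@[simp] theorem cx_lineY (p : 𝔼 4) (c : ℂ) (t : ℝ) : cx (lineY p c t) = cx p := by
  simp [lineY, cx_add, cx_smul]

/-- `y`-coordinate along the `y`-line. [folklore] -/
@[simp] theorem cy_lineY (p : 𝔼 4) (c : ℂ) (t : ℝ) : cy (lineY p c t) = cy p + t * c := by
  simp [lineY, cy_add, cy_smul]

/-- Velocity of the `x`-line. [folklore] -/
theorem hasDerivAt_lineX (p : 𝔼 4) (u : ℂ) (t : ℝ) : HasDerivAt (lineX p u) (mk u 0) t := by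
  have h := ((hasDerivAt_id t).smul_const (mk u 0)).const_add p
  simp only [one_smul] at h
  exact h

/-- Velocity of the `y`-line. [folklore] -/
theorem hasDerivAt_lineY (p : 𝔼 4) (c : ℂ) (t : ℝ) : HasDerivAt (lineY p c) (mk 0 c) t := by
  have h := ((hasDerivAt_id t).smul_const (mk 0 c)).const_add p
  simp only [one_smul] at h
  exact h

/-- The `x`-line starts at `p`. [folklore] -/
@[simp] theorem lineX_zero (p : 𝔼 4) (u : ℂ) : lineX p u 0 = p := by simp [lineX]

/-- The `y`-line starts at `p`. [folklore] -/
@[simp] theorem lineY_zero (p : 𝔼 4) (c : ℂ) : lineY p c 0 = p := by simp [lineY]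

end LefschetzBase

end Literature.Topology.FourManifolds
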